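import Summits.QuantumFields.BalabanUV.Beta.FP.TorusCompositeInsertionKernelSym
import Summits.QuantumFields.BalabanUV.Beta.FP.TorusCompositeInsertionPeriodicTwoSym
import Summits.QuantumFields.BalabanUV.Beta.FP.TorusCompositeInsertionKernelTwo

/-!
# `BalabanUV.Beta.FP.TorusCompositeInsertionKernelTwoSym` — road «FP» for binder row D1, ROUTE T, (β1) «sym» column: **THE KERNEL-LEVEL (S3-2) FORM OF THE ORDER-2
# SYM COMPOSITE JUNCTION** — the entries of OUR sym composite second-order insertion bi-jet `compIns₂₂Sym … n h h′` as the `h ⊗ h′`-weighted sum over ALL PAIRS OF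
# COPIES of a two-bond lattice family `𝒲` whose border entries are a kernel of the bi-functional `𝓘₂` (the (β1) twin of `TorusCompositeInsertionKernelTwo`; the shape the
# `-Sym` door's 𝔔-side binding `hQF₂ ∕ hQN₂ : ½ • (Q₁₂f (dv a₁) (dv a₂) + Q₁₂f (dv a₂) (dv a₁)) = (perF T (dper T (𝒲 μ 0 ν z))).submatrix fF ff` reads)

WHY.  `TorusCompositeInsertionPeriodicTwoSym` identifies the ACTION of `compIns₂₂Sym … n h h′` on finest-periodic forms with any bi-functional `𝓘₂` obeying OUR sym
second chain rule over (`𝓡`, `𝓘₁`) (clauses `hR0 hRsucc h0₁ hsucc₁ h0₂ hsucc₂`).  §1 reads off the ENTRIES at the periodic indicator of a torus bond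
(`compIns₂₂Sym_apply_eq`).  For a two-bond family `𝒲 κ u κ′ u′ : MKer` (indexed by the two background LATTICE bonds), windowed in the fluctuation slot and in both
family bonds (`hS hT hT′`) and whose `(inr κ₀, inl l)` entries at the coarse multiplier sites `Lc^n • x̄` are a kernel of `𝓘₂ lev n` (`h𝒲`), §3 gives the EXACT
identity for all torus weights `h, h′` (at the centred tower, every root list `rs`):
  `Σ_{b,b′} h b · h′ b′ · Σ'_{m₁} Σ'_{m₂} Σ'_m 𝒲 b.2 (b.1 + T∘m₁) b′.2 (b′.1 + T∘m₂) (Lc^n • x̄) (z + T∘m) (inr κ₀) (inl β) = compIns₂₂Sym Lc M lev rs n h h′ (x̄, κ₀) (z, β)`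
— ALL pairs of copies `(m₁, m₂)` of the two torus bonds load (`T = towerTorus Lc M n`).  (The DIAGONAL periodisation `perZ T (dper T (𝒲 κ u κ′ u′))` the socket binds
is the simultaneous-copies sum; its single-bond-pair reading under the separation letter is the rooted `TorusCompositeInsertionKernelSingle`'s business and twins the
same way — not here.)  §2 is the two-variable lift engine (a copy of the rooted file's, not yet importable).  No lattice object is DEFINED; `𝒲`, `𝓡`, `𝓘₁`, `𝓘₂`
are the row's.  The proofs are the rooted file's, line for line; only the steps `h𝒲` and `compIns₂₂Sym_apply_eq` see the functionals.

[folklore] finite sums + finitely supported `tsum` re-indexing BY NAME (`TorusCompositeInsertionKernelSym.tsum_mul_indicator_wrap`, `TorusStepInsertionPeriodicTwo`'s lift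
engine `sum_mul_tsum_translate_eq_tsum_lift`, `sum_compIns₂₂Sym_mul_periodic`, Mathlib `Summable.tsum_finsetSum`); no `def`, no `def … : Prop`, nothing cited, 0 sorry;
NO chart; nothing of Bałaban's asserted.  NOT HERE: the row's `𝒲` and the proof that its border entries are a kernel of the row's `𝓘₂` — that identity IS the (C1)
TABLE word at order 2; the field–field blocks; estimates.

HONEST DEPENDENCY (page 1, mandatory): continuum YM on T⁴ ⇐ BetaPertH ∧ nine spine estimates (0/9 proved); BetaPertH ⇐ (D1) ∧ (D4) ∧ CAP+tail;
G-an2-4 gates asym, D1 and NE2/3/4.  HONEST FRAMING (cell contract, verbatim): «discharging `BetaPertH` makes Bałaban's UV stability UNCONDITIONAL —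
a real constructive-QFT result; it is NOT the continuum limit and NOT the Clay problem.»  ABSOLUTE RULE (cell charter, verbatim): «No internally-minted
statement may enter as a cited fact. Every hypothesis is either kernel-proved in this package or a verbatim quotation of a PUBLISHED theorem with page
reference. The manuscript(s) under audit are NOT citable for their own disputed steps — they are the thing under adjudication; programme-internal
(2001/route/tribunal) claims are never citable.»  0 estimates; 0∕4 row-D1 binders (hW, hR, D1Tel, D1Rep); NOT (T-ID), NOT (C1), NOT SDF, NOT D1,
NOT BetaPertH, NOT continuum, NOT Clay.  D1 formalisation swarm LEAF PROVER 02 (b2b-balaban-beta-d1-formalise-leaf-02 gen 32), 2026-08-24.  No existing file touched.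
v1.1 (leaf-02 g33, 2026-08-25): the kernel-generic engine `sum_sum_mul_tsum_translate₂_eq_tsum_lift₂` is READ BY NAME from the rooted R-10 `TorusCompositeInsertionKernelTwo` instead of re-typed (`dedup.landed` is α-invariant); `tsum_mul_indicator_wrap` opened from the rooted R-9; the other declarations byte-identical to v1 c9a90df482feba84.
-/

noncomputable section

open scoped BigOperators

namespace Summit.QuantumFields.BalabanUV.Beta.FP.TorusCompositeInsertionKernelTwoSym

open Matrix Finset
open Literature.MathematicalPhysics.QuantumFieldTheory
open Literature.MathematicalPhysics.QuantumFieldTheory.Balaban1983to89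
open Literature.MathematicalPhysics.QuantumFieldTheory.Balaban1983to89.Beta
open B5Prop11Plancherel (fine)
open B6Lemma24Torus (pbox mem_pbox wrap)
open B4TorusKernel.MultiPeriod (translate translate_apply)
open ExpKernelCalculus (MKer)
open AffineAveraging (Site Form1 box toSite)
open AveragingContoursRooted (ctr ctrOff)
open OneStepResolventKernel (Fib)
open Summit.QuantumFields.BalabanUV.Beta.BorderedHessian (stepScale)
open Summit.QuantumFields.BalabanUV.Beta.SymAveragingHessianCounts (symVhKerAt symLinKerAt)
open Summit.QuantumFields.BalabanUV.Beta.SymAveragingMixedJetTables (symVh2KerAt)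
open Summit.QuantumFields.BalabanUV.Beta.GAN24.KernelPeriodisation (wrap_translate)
open Summit.QuantumFields.BalabanUV.Beta.FP.TorusGaugeCovariancePairing (wrapPt wrapPt_coe wrapPt_of_mem)
open Summit.QuantumFields.BalabanUV.Beta.FP.TorusCompositeObjects (towerTorus towerTorus_apply)
open Summit.QuantumFields.BalabanUV.Beta.FP.TorusCompositeCovarianceTwoPolarSym (compIns₂₂Sym)
open Summit.QuantumFields.BalabanUV.Beta.FP.TorusStepInsertionPeriodic (exists_finset_translate)
open Summit.QuantumFields.BalabanUV.Beta.FP.TorusStepInsertionPeriodicTwo (sum_mul_tsum_translate_eq_tsum_lift)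
open Summit.QuantumFields.BalabanUV.Beta.FP.TorusCompositeInsertionPeriodicSym (rows_periodic_of_clauses periodic_of_clauses)
open Summit.QuantumFields.BalabanUV.Beta.FP.TorusCompositeInsertionPeriodicTwoSym (sum_compIns₂₂Sym_mul_periodic periodic_of_clauses₂)
open Summit.QuantumFields.BalabanUV.Beta.FP.TorusCompositeInsertionKernel (tsum_mul_indicator_wrap)
open Summit.QuantumFields.BalabanUV.Beta.FP.TorusCompositeInsertionKernelTwo (sum_sum_mul_tsum_translate₂_eq_tsum_lift₂)

variable {d : ℕ} (Lc : ℕ) [NeZero Lc]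

/-! ## §1 The entries of `compIns₂₂Sym … n h h′`: the bi-functional at (the two lifts, the periodic indicator of a torus bond) -/

/-- [folklore] **THE ENTRIES OF THE SYM COMPOSITE SECOND-ORDER INSERTION BI-JET** (`compIns₁Sym_apply_eq` one order up): for any `𝓡, 𝓘₁, 𝓘₂` with the clauses
`hR0 hRsucc h0₁ hsucc₁ h0₂ hsucc₂` (letters from `rows_periodic_of_clauses ∕ periodic_of_clauses ∕ periodic_of_clauses₂`),
`compIns₂₂Sym Lc M lev rs n h h′ (x, κ₀) (z, β) = 𝓘₂ lev n (lift h) (lift h′) ((l, w) ↦ δ_{(β,z)} (l, wrap T w)) κ₀ x`, `T = towerTorus Lc M n`. -/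
theorem compIns₂₂Sym_apply_eq
    (hc : ctrOff (d + 1) Lc ∈ box (d + 1) Lc)
    (𝓡 : (ℕ → ℕ) → ℕ → Form1 (d + 1) ℝ → Form1 (d + 1) ℝ)
    (hR0 : ∀ (lev : ℕ → ℕ) (B : Form1 (d + 1) ℝ), 𝓡 lev 0 B = B)
    (hRsucc : ∀ (lev : ℕ → ℕ) (n : ℕ) (B : Form1 (d + 1) ℝ) (κ : Fin (d + 1)) (x : Site (d + 1)),
      𝓡 lev (n + 1) B κ x = stepScale d Lc (lev 1) * ((Lc : ℝ) ^ (d + 1)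
        * ∑' z : Site (d + 1), ∑ l : Fin (d + 1), symLinKerAt (ctr (d + 1) Lc) Lc κ x (l, z) * 𝓡 (fun k => lev (k + 1)) n B l z))
    (𝓘₁ : (ℕ → ℕ) → ℕ → Form1 (d + 1) ℝ → Form1 (d + 1) ℝ → Form1 (d + 1) ℝ)
    (h0₁ : ∀ (lev : ℕ → ℕ) (H B : Form1 (d + 1) ℝ), 𝓘₁ lev 0 H B = 0)
    (hsucc₁ : ∀ (lev : ℕ → ℕ) (n : ℕ) (H B : Form1 (d + 1) ℝ) (κ : Fin (d + 1)) (x : Site (d + 1)),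
      𝓘₁ lev (n + 1) H B κ x
        = (((Lc : ℝ) ^ (d + 1) * stepScale d Lc (lev 1)) * (∏ i ∈ Finset.range n, (stepScale d Lc (lev (i + 1 + 1)) * ((box (d + 1) Lc).card : ℝ)))⁻¹) *
            (∑' u : Site (d + 1), ∑ κ' : Fin (d + 1),
              (∑' z : Site (d + 1), ∑ l : Fin (d + 1), symVhKerAt (ctr (d + 1) Lc) Lc κ x (l, z) (κ', u) * 𝓡 (fun k => lev (k + 1)) n B l z) *
                𝓡 (fun k => lev (k + 1)) n H κ' u)
          + stepScale d Lc (lev 1) * ((Lc : ℝ) ^ (d + 1) *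
              ∑' z : Site (d + 1), ∑ l : Fin (d + 1), symLinKerAt (ctr (d + 1) Lc) Lc κ x (l, z) * 𝓘₁ (fun k => lev (k + 1)) n H B l z))
    (𝓘₂ : (ℕ → ℕ) → ℕ → Form1 (d + 1) ℝ → Form1 (d + 1) ℝ → Form1 (d + 1) ℝ → Form1 (d + 1) ℝ)
    (h0₂ : ∀ (lev : ℕ → ℕ) (H H' B : Form1 (d + 1) ℝ), 𝓘₂ lev 0 H H' B = 0)
    (hsucc₂ : ∀ (lev : ℕ → ℕ) (n : ℕ) (H H' B : Form1 (d + 1) ℝ) (κ₀ : Fin (d + 1)) (x : Site (d + 1)),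
      𝓘₂ lev (n + 1) H H' B κ₀ x
        = ((((Lc : ℝ) ^ (d + 1) * stepScale d Lc (lev 1)) * (∏ i ∈ Finset.range n, (stepScale d Lc (lev (i + 1 + 1)) * ((box (d + 1) Lc).card : ℝ)))⁻¹)
            * (∏ i ∈ Finset.range n, (stepScale d Lc (lev (i + 1 + 1)) * ((box (d + 1) Lc).card : ℝ)))⁻¹) *
            (∑' u : Site (d + 1), ∑ κ : Fin (d + 1), (∑' u' : Site (d + 1), ∑ κ' : Fin (d + 1),
              (∑' z : Site (d + 1), ∑ l : Fin (d + 1),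
                (1 / 2 : ℝ) * (symVh2KerAt (ctr (d + 1) Lc) Lc κ₀ x (l, z) (κ, u) (κ', u') + symVh2KerAt (ctr (d + 1) Lc) Lc κ₀ x (l, z) (κ', u') (κ, u)) *
                  𝓡 (fun k => lev (k + 1)) n B l z) *
              𝓡 (fun k => lev (k + 1)) n H' κ' u') * 𝓡 (fun k => lev (k + 1)) n H κ u)
          + (((Lc : ℝ) ^ (d + 1) * stepScale d Lc (lev 1)) * (∏ i ∈ Finset.range n, (stepScale d Lc (lev (i + 1 + 1)) * ((box (d + 1) Lc).card : ℝ)))⁻¹) *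
            ((∑' u : Site (d + 1), ∑ κ' : Fin (d + 1),
              (∑' z : Site (d + 1), ∑ l : Fin (d + 1), symVhKerAt (ctr (d + 1) Lc) Lc κ₀ x (l, z) (κ', u) * 𝓘₁ (fun k => lev (k + 1)) n H' B l z) *
                𝓡 (fun k => lev (k + 1)) n H κ' u)
            + (∑' u : Site (d + 1), ∑ κ' : Fin (d + 1),
              (∑' z : Site (d + 1), ∑ l : Fin (d + 1), symVhKerAt (ctr (d + 1) Lc) Lc κ₀ x (l, z) (κ', u) * 𝓘₁ (fun k => lev (k + 1)) n H B l z) *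
                𝓡 (fun k => lev (k + 1)) n H' κ' u))
          + stepScale d Lc (lev 1) * ((Lc : ℝ) ^ (d + 1) *
              ∑' z : Site (d + 1), ∑ l : Fin (d + 1), symLinKerAt (ctr (d + 1) Lc) Lc κ₀ x (l, z) * 𝓘₂ (fun k => lev (k + 1)) n H H' B l z))
    (n : ℕ) (M : Fin (d + 1) → ℕ) [∀ μ, NeZero (M μ)] (lev : ℕ → ℕ) (rs : ℕ → (Fin (d + 1) → ℕ))
    (h h' : ↥(pbox (towerTorus Lc M n)) × Fin (d + 1) → ℝ) (x : ↥(pbox M)) (κ₀ : Fin (d + 1)) (z : ↥(pbox (towerTorus Lc M n))) (β : Fin (d + 1)) :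
    compIns₂₂Sym Lc M lev rs n h h' (x, κ₀) (z, β)
      = 𝓘₂ lev n (fun l w => h (wrapPt (towerTorus Lc M n) w, l)) (fun l w => h' (wrapPt (towerTorus Lc M n) w, l))
          (fun l w => KKTFluctuationKernel.delta1 β (z : Site (d + 1)) l (wrap (towerTorus Lc M n) w)) κ₀ (x : Site (d + 1)) := by
  classical
  have hA : ∀ (l : Fin (d + 1)) (w t : Site (d + 1)),
      (fun l w => KKTFluctuationKernel.delta1 β (z : Site (d + 1)) l (wrap (towerTorus Lc M n) w)) l (translate (towerTorus Lc M n) w t)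
        = (fun l w => KKTFluctuationKernel.delta1 β (z : Site (d + 1)) l (wrap (towerTorus Lc M n) w)) l w := fun l w t => by
    show KKTFluctuationKernel.delta1 β _ l (wrap _ (translate _ w t)) = KKTFluctuationKernel.delta1 β _ l (wrap _ w)
    rw [B6Lemma24Torus.wrap_congr (x' := w)]
    intro i
    rw [translate_apply]
    exact ⟨t i, by ring⟩
  rw [← sum_compIns₂₂Sym_mul_periodic Lc hc 𝓡 hR0 hRsucc (fun lev n T B => rows_periodic_of_clauses Lc 𝓡 hR0 hRsucc n lev T B) 𝓘₁ h0₁ hsucc₁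
    (fun lev n M H B => periodic_of_clauses Lc 𝓡 hR0 hRsucc 𝓘₁ h0₁ hsucc₁ n lev M H B) 𝓘₂ h0₂ hsucc₂
    (fun lev n M H H' B => periodic_of_clauses₂ Lc 𝓡 hR0 hRsucc 𝓘₁ h0₁ hsucc₁ 𝓘₂ h0₂ hsucc₂ n lev M H H' B) n M lev rs h h' _ hA x κ₀]
  have hval : ∀ q : ↥(pbox (towerTorus Lc M n)) × Fin (d + 1),
      (fun l w => KKTFluctuationKernel.delta1 β (z : Site (d + 1)) l (wrap (towerTorus Lc M n) w)) q.2 (q.1 : Site (d + 1))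
        = if q = (z, β) then 1 else 0 := fun q => by
    show KKTFluctuationKernel.delta1 β _ q.2 (wrap _ _) = _
    rw [B6Lemma24Torus.wrap_eq_self q.1.2, KKTFluctuationKernel.delta1_apply]
    obtain ⟨w, l⟩ := q
    by_cases hq : (w, l) = (z, β)
    · rw [if_pos hq, if_pos]
      obtain ⟨h1, h2⟩ := Prod.mk.inj hq
      exact ⟨h2, by rw [h1]⟩
    · rw [if_neg hq, if_neg]
      rintro ⟨h2, h1⟩
      exact hq (Prod.ext (Subtype.ext h1) h2)
  simp only [hval, mul_ite, mul_one, mul_zero, Finset.sum_ite_eq', Finset.mem_univ, if_true]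

/-! ## §2 Plumbing: the two-variable lift engine -/

/-! ## §3 The kernel-level junction at order 2: all pairs of copies load -/

/-- [folklore] **`sum_sum_mul_tsum₂_eq_compIns₂₂Sym_apply` — THE KERNEL-LEVEL (S3-2) FORM OF THE ORDER-2 SYM COMPOSITE JUNCTION, EXACT AT EVERY BOX.**  Letters:
`hR0 hRsucc h0₁ hsucc₁ h0₂ hsucc₂` — OUR sym chain rules; `hS ∕ hT ∕ hT′` — windows in the fluctuation slot and in the two family bonds for a fixed multiplier site;
`h𝒲` — the border entries of `𝒲` at the coarse multiplier sites are a kernel of `𝓘₂ lev n` (nesting of `hsucc₂`: first bond outer, second bond inner).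
Conclusion, for all torus weights `h, h′` and all slots (`T = towerTorus Lc M n`):
`Σ_{b,b′} h b · h′ b′ · Σ'_{m₁} Σ'_{m₂} Σ'_m 𝒲 b.2 (b.1 + T∘m₁) b′.2 (b′.1 + T∘m₂) (Lc^n • x̄) (z + T∘m) (inr κ₀) (inl β) = compIns₂₂Sym Lc M lev rs n h h′ (x̄, κ₀) (z, β)`. -/
theorem sum_sum_mul_tsum₂_eq_compIns₂₂Sym_apply
    (hc : ctrOff (d + 1) Lc ∈ box (d + 1) Lc)
    (𝓡 : (ℕ → ℕ) → ℕ → Form1 (d + 1) ℝ → Form1 (d + 1) ℝ)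
    (hR0 : ∀ (lev : ℕ → ℕ) (B : Form1 (d + 1) ℝ), 𝓡 lev 0 B = B)
    (hRsucc : ∀ (lev : ℕ → ℕ) (n : ℕ) (B : Form1 (d + 1) ℝ) (κ : Fin (d + 1)) (x : Site (d + 1)),
      𝓡 lev (n + 1) B κ x = stepScale d Lc (lev 1) * ((Lc : ℝ) ^ (d + 1)
        * ∑' z : Site (d + 1), ∑ l : Fin (d + 1), symLinKerAt (ctr (d + 1) Lc) Lc κ x (l, z) * 𝓡 (fun k => lev (k + 1)) n B l z))
    (𝓘₁ : (ℕ → ℕ) → ℕ → Form1 (d + 1) ℝ → Form1 (d + 1) ℝ → Form1 (d + 1) ℝ)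
    (h0₁ : ∀ (lev : ℕ → ℕ) (H B : Form1 (d + 1) ℝ), 𝓘₁ lev 0 H B = 0)
    (hsucc₁ : ∀ (lev : ℕ → ℕ) (n : ℕ) (H B : Form1 (d + 1) ℝ) (κ : Fin (d + 1)) (x : Site (d + 1)),
      𝓘₁ lev (n + 1) H B κ x
        = (((Lc : ℝ) ^ (d + 1) * stepScale d Lc (lev 1)) * (∏ i ∈ Finset.range n, (stepScale d Lc (lev (i + 1 + 1)) * ((box (d + 1) Lc).card : ℝ)))⁻¹) *
            (∑' u : Site (d + 1), ∑ κ' : Fin (d + 1),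
              (∑' z : Site (d + 1), ∑ l : Fin (d + 1), symVhKerAt (ctr (d + 1) Lc) Lc κ x (l, z) (κ', u) * 𝓡 (fun k => lev (k + 1)) n B l z) *
                𝓡 (fun k => lev (k + 1)) n H κ' u)
          + stepScale d Lc (lev 1) * ((Lc : ℝ) ^ (d + 1) *
              ∑' z : Site (d + 1), ∑ l : Fin (d + 1), symLinKerAt (ctr (d + 1) Lc) Lc κ x (l, z) * 𝓘₁ (fun k => lev (k + 1)) n H B l z))
    (𝓘₂ : (ℕ → ℕ) → ℕ → Form1 (d + 1) ℝ → Form1 (d + 1) ℝ → Form1 (d + 1) ℝ → Form1 (d + 1) ℝ)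
    (h0₂ : ∀ (lev : ℕ → ℕ) (H H' B : Form1 (d + 1) ℝ), 𝓘₂ lev 0 H H' B = 0)
    (hsucc₂ : ∀ (lev : ℕ → ℕ) (n : ℕ) (H H' B : Form1 (d + 1) ℝ) (κ₀ : Fin (d + 1)) (x : Site (d + 1)),
      𝓘₂ lev (n + 1) H H' B κ₀ x
        = ((((Lc : ℝ) ^ (d + 1) * stepScale d Lc (lev 1)) * (∏ i ∈ Finset.range n, (stepScale d Lc (lev (i + 1 + 1)) * ((box (d + 1) Lc).card : ℝ)))⁻¹)
            * (∏ i ∈ Finset.range n, (stepScale d Lc (lev (i + 1 + 1)) * ((box (d + 1) Lc).card : ℝ)))⁻¹) *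
            (∑' u : Site (d + 1), ∑ κ : Fin (d + 1), (∑' u' : Site (d + 1), ∑ κ' : Fin (d + 1),
              (∑' z : Site (d + 1), ∑ l : Fin (d + 1),
                (1 / 2 : ℝ) * (symVh2KerAt (ctr (d + 1) Lc) Lc κ₀ x (l, z) (κ, u) (κ', u') + symVh2KerAt (ctr (d + 1) Lc) Lc κ₀ x (l, z) (κ', u') (κ, u)) *
                  𝓡 (fun k => lev (k + 1)) n B l z) *
              𝓡 (fun k => lev (k + 1)) n H' κ' u') * 𝓡 (fun k => lev (k + 1)) n H κ u)
          + (((Lc : ℝ) ^ (d + 1) * stepScale d Lc (lev 1)) * (∏ i ∈ Finset.range n, (stepScale d Lc (lev (i + 1 + 1)) * ((box (d + 1) Lc).card : ℝ)))⁻¹) *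
            ((∑' u : Site (d + 1), ∑ κ' : Fin (d + 1),
              (∑' z : Site (d + 1), ∑ l : Fin (d + 1), symVhKerAt (ctr (d + 1) Lc) Lc κ₀ x (l, z) (κ', u) * 𝓘₁ (fun k => lev (k + 1)) n H' B l z) *
                𝓡 (fun k => lev (k + 1)) n H κ' u)
            + (∑' u : Site (d + 1), ∑ κ' : Fin (d + 1),
              (∑' z : Site (d + 1), ∑ l : Fin (d + 1), symVhKerAt (ctr (d + 1) Lc) Lc κ₀ x (l, z) (κ', u) * 𝓘₁ (fun k => lev (k + 1)) n H B l z) *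
                𝓡 (fun k => lev (k + 1)) n H' κ' u))
          + stepScale d Lc (lev 1) * ((Lc : ℝ) ^ (d + 1) *
              ∑' z : Site (d + 1), ∑ l : Fin (d + 1), symLinKerAt (ctr (d + 1) Lc) Lc κ₀ x (l, z) * 𝓘₂ (fun k => lev (k + 1)) n H H' B l z))
    (n : ℕ) (M : Fin (d + 1) → ℕ) [∀ μ, NeZero (M μ)] (lev : ℕ → ℕ) (rs : ℕ → (Fin (d + 1) → ℕ))
    (𝒲 : Fin (d + 1) → Site (d + 1) → Fin (d + 1) → Site (d + 1) → MKer (d + 1) (Fib d)) (W : Site (d + 1) → Finset (Site (d + 1)))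
    (hS : ∀ (κ : Fin (d + 1)) (u : Site (d + 1)) (κ' : Fin (d + 1)) (u' x : Site (d + 1)) (μ α : Fin (d + 1)), ∀ z ∉ W x,
      𝒲 κ u κ' u' x z (Sum.inr μ) (Sum.inl α) = 0)
    (hT : ∀ (κ κ' : Fin (d + 1)) (u' x z : Site (d + 1)) (μ α : Fin (d + 1)), ∀ u ∉ W x, 𝒲 κ u κ' u' x z (Sum.inr μ) (Sum.inl α) = 0)
    (hT' : ∀ (κ : Fin (d + 1)) (u : Site (d + 1)) (κ' : Fin (d + 1)) (x z : Site (d + 1)) (μ α : Fin (d + 1)), ∀ u' ∉ W x,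
      𝒲 κ u κ' u' x z (Sum.inr μ) (Sum.inl α) = 0)
    (h𝒲 : ∀ (H H' B : Form1 (d + 1) ℝ) (κ₀ : Fin (d + 1)) (x : Site (d + 1)),
      (∑' u : Site (d + 1), ∑ κ : Fin (d + 1), (∑' u' : Site (d + 1), ∑ κ' : Fin (d + 1),
        (∑' z : Site (d + 1), ∑ l : Fin (d + 1), 𝒲 κ u κ' u' ((((Lc ^ n : ℕ) : ℤ)) • x) z (Sum.inr κ₀) (Sum.inl l) * B l z) * H' κ' u') * H κ u)
        = 𝓘₂ lev n H H' B κ₀ x)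
    (h h' : ↥(pbox (towerTorus Lc M n)) × Fin (d + 1) → ℝ) (x : ↥(pbox M)) (κ₀ : Fin (d + 1)) (z : ↥(pbox (towerTorus Lc M n))) (β : Fin (d + 1)) :
    ∑ b : ↥(pbox (towerTorus Lc M n)) × Fin (d + 1), ∑ b' : ↥(pbox (towerTorus Lc M n)) × Fin (d + 1), h b * (h' b' *
        ∑' m₁ : Site (d + 1), ∑' m₂ : Site (d + 1), ∑' m : Site (d + 1),
          𝒲 b.2 (translate (towerTorus Lc M n) (b.1 : Site (d + 1)) m₁) b'.2 (translate (towerTorus Lc M n) (b'.1 : Site (d + 1)) m₂)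
            ((((Lc ^ n : ℕ) : ℤ)) • (x : Site (d + 1))) (translate (towerTorus Lc M n) (z : Site (d + 1)) m) (Sum.inr κ₀) (Sum.inl β))
      = compIns₂₂Sym Lc M lev rs n h h' (x, κ₀) (z, β) := by
  classical
  -- the copy sum in the fluctuation site is `𝒲` against the periodic indicator of the torus bond `(z, β)` (`tsum_mul_indicator_wrap`)
  have hind : ∀ (κ : Fin (d + 1)) (v : Site (d + 1)) (κ' : Fin (d + 1)) (v' : Site (d + 1)),
      (∑' m : Site (d + 1), 𝒲 κ v κ' v' ((((Lc ^ n : ℕ) : ℤ)) • (x : Site (d + 1))) (translate (towerTorus Lc M n) (z : Site (d + 1)) m) (Sum.inr κ₀) (Sum.inl β))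
        = ∑' z' : Site (d + 1), ∑ l : Fin (d + 1), 𝒲 κ v κ' v' ((((Lc ^ n : ℕ) : ℤ)) • (x : Site (d + 1))) z' (Sum.inr κ₀) (Sum.inl l) *
            (fun l w => KKTFluctuationKernel.delta1 β (z : Site (d + 1)) l (wrap (towerTorus Lc M n) w)) l z' := fun κ v κ' v' => by
    have hsingle : ∀ z' : Site (d + 1), ∑ l : Fin (d + 1), 𝒲 κ v κ' v' ((((Lc ^ n : ℕ) : ℤ)) • (x : Site (d + 1))) z' (Sum.inr κ₀) (Sum.inl l) *
        (fun l w => KKTFluctuationKernel.delta1 β (z : Site (d + 1)) l (wrap (towerTorus Lc M n) w)) l z'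
          = 𝒲 κ v κ' v' ((((Lc ^ n : ℕ) : ℤ)) • (x : Site (d + 1))) z' (Sum.inr κ₀) (Sum.inl β) *
              (if wrap (towerTorus Lc M n) z' = (z : Site (d + 1)) then (1 : ℝ) else 0) := fun z' => by
      have hl : ∀ l : Fin (d + 1), 𝒲 κ v κ' v' ((((Lc ^ n : ℕ) : ℤ)) • (x : Site (d + 1))) z' (Sum.inr κ₀) (Sum.inl l) *
          (fun l w => KKTFluctuationKernel.delta1 β (z : Site (d + 1)) l (wrap (towerTorus Lc M n) w)) l z'
            = if l = β then 𝒲 κ v κ' v' ((((Lc ^ n : ℕ) : ℤ)) • (x : Site (d + 1))) z' (Sum.inr κ₀) (Sum.inl β) *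
                (if wrap (towerTorus Lc M n) z' = (z : Site (d + 1)) then (1 : ℝ) else 0) else 0 := fun l => by
        show _ * KKTFluctuationKernel.delta1 β _ l (wrap _ z') = _
        rw [KKTFluctuationKernel.delta1_apply]
        by_cases hl : l = β
        · subst hl; simp
        · rw [if_neg (fun hc => hl hc.1), if_neg hl, mul_zero]
      rw [Finset.sum_congr rfl fun l _ => hl l, Finset.sum_ite_eq' Finset.univ β]
      simp only [Finset.mem_univ, if_true]
    rw [tsum_congr hsingle]
    exact (tsum_mul_indicator_wrap (towerTorus Lc M n) _ (W ((((Lc ^ n : ℕ) : ℤ)) • (x : Site (d + 1))))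
      (fun z' hz' => hS κ v κ' v' _ κ₀ β z' hz') z).symm
  -- windows of the copy sum in the two family bonds
  have hG₁ : ∀ (κ κ' : Fin (d + 1)) (v' : Site (d + 1)), ∀ v ∉ W ((((Lc ^ n : ℕ) : ℤ)) • (x : Site (d + 1))),
      (∑' m : Site (d + 1), 𝒲 κ v κ' v' ((((Lc ^ n : ℕ) : ℤ)) • (x : Site (d + 1))) (translate (towerTorus Lc M n) (z : Site (d + 1)) m) (Sum.inr κ₀) (Sum.inl β)) = 0 :=
    fun κ κ' v' v hv => (tsum_congr fun m => hT κ κ' v' _ _ κ₀ β v hv).trans tsum_zero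
  have hG₂ : ∀ (κ : Fin (d + 1)) (v : Site (d + 1)) (κ' : Fin (d + 1)), ∀ v' ∉ W ((((Lc ^ n : ℕ) : ℤ)) • (x : Site (d + 1))),
      (∑' m : Site (d + 1), 𝒲 κ v κ' v' ((((Lc ^ n : ℕ) : ℤ)) • (x : Site (d + 1))) (translate (towerTorus Lc M n) (z : Site (d + 1)) m) (Sum.inr κ₀) (Sum.inl β)) = 0 :=
    fun κ v κ' v' hv' => (tsum_congr fun m => hT' κ v κ' _ _ κ₀ β v' hv').trans tsum_zero
  -- assemble: two-variable lift engine ↦ indicator ↦ `h𝒲` ↦ §1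
  calc ∑ b : ↥(pbox (towerTorus Lc M n)) × Fin (d + 1), ∑ b' : ↥(pbox (towerTorus Lc M n)) × Fin (d + 1), h b * (h' b' *
          ∑' m₁ : Site (d + 1), ∑' m₂ : Site (d + 1), ∑' m : Site (d + 1),
            𝒲 b.2 (translate (towerTorus Lc M n) (b.1 : Site (d + 1)) m₁) b'.2 (translate (towerTorus Lc M n) (b'.1 : Site (d + 1)) m₂)
              ((((Lc ^ n : ℕ) : ℤ)) • (x : Site (d + 1))) (translate (towerTorus Lc M n) (z : Site (d + 1)) m) (Sum.inr κ₀) (Sum.inl β))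
      = ∑' u : Site (d + 1), ∑ κ : Fin (d + 1), (∑' u' : Site (d + 1), ∑ κ' : Fin (d + 1),
          (∑' m : Site (d + 1), 𝒲 κ u κ' u' ((((Lc ^ n : ℕ) : ℤ)) • (x : Site (d + 1)))
            (translate (towerTorus Lc M n) (z : Site (d + 1)) m) (Sum.inr κ₀) (Sum.inl β)) * h' (wrapPt (towerTorus Lc M n) u', κ')) *
          h (wrapPt (towerTorus Lc M n) u, κ) :=
        sum_sum_mul_tsum_translate₂_eq_tsum_lift₂ (towerTorus Lc M n)
          (fun κ v κ' v' => ∑' m : Site (d + 1), 𝒲 κ v κ' v' ((((Lc ^ n : ℕ) : ℤ)) • (x : Site (d + 1)))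
            (translate (towerTorus Lc M n) (z : Site (d + 1)) m) (Sum.inr κ₀) (Sum.inl β)) _ hG₁ hG₂ h h'
    _ = ∑' u : Site (d + 1), ∑ κ : Fin (d + 1), (∑' u' : Site (d + 1), ∑ κ' : Fin (d + 1),
          (∑' z' : Site (d + 1), ∑ l : Fin (d + 1), 𝒲 κ u κ' u' ((((Lc ^ n : ℕ) : ℤ)) • (x : Site (d + 1))) z' (Sum.inr κ₀) (Sum.inl l) *
            (fun l w => KKTFluctuationKernel.delta1 β (z : Site (d + 1)) l (wrap (towerTorus Lc M n) w)) l z')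
            * (fun l w => h' (wrapPt (towerTorus Lc M n) w, l)) κ' u') * (fun l w => h (wrapPt (towerTorus Lc M n) w, l)) κ u :=
        tsum_congr fun u => Finset.sum_congr rfl fun κ _ => by
          refine congrArg (fun t : ℝ => t * _) ?_
          exact tsum_congr fun u' => Finset.sum_congr rfl fun κ' _ => by rw [hind]
    _ = 𝓘₂ lev n (fun l w => h (wrapPt (towerTorus Lc M n) w, l)) (fun l w => h' (wrapPt (towerTorus Lc M n) w, l))
          (fun l w => KKTFluctuationKernel.delta1 β (z : Site (d + 1)) l (wrap (towerTorus Lc M n) w)) κ₀ (x : Site (d + 1)) := h𝒲 _ _ _ κ₀ _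
    _ = compIns₂₂Sym Lc M lev rs n h h' (x, κ₀) (z, β) :=
        (compIns₂₂Sym_apply_eq Lc hc 𝓡 hR0 hRsucc 𝓘₁ h0₁ hsucc₁ 𝓘₂ h0₂ hsucc₂ n M lev rs h h' x κ₀ z β).symm

end Summit.QuantumFields.BalabanUV.Beta.FP.TorusCompositeInsertionKernelTwoSym

end
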